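import Mathlib.Analysis.SpecialFunctions.Pow.Real
import Mathlib.Analysis.SpecialFunctions.Log.Basic
import Mathlib.Analysis.SpecialFunctions.Sqrt
import Mathlib.Algebra.BigOperators.Group.Finset.Basic
import Mathlib.Algebra.Order.BigOperators.Group.Finset

/-!
# SoloBlind — a subcritical free Bose gas dominates with exponential decay

Solo-blind `AtomisticToContinuum / BoseEinsteinCondensation`, census line N15 / claim C131
(Proposition 13.16 (ii) of the wall statement).

Inside the Fröhlich–Park sine-Gordon cone the interacting one-body density matrix of the
charge-symmetric Bose plasma is dominated pointwise by the FREE Bose gas at the renormalised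
fugacity `ζ = z·exp(βW(0)/2) < 1`,

  `γ^{id}_ζ(r) = Σ_{n ≥ 1} ζⁿ (4πnβ)^{−3/2} exp(−r²/(4nβ))`.

This file proves the elementary decay estimate used there: for `0 < ζ < 1`, `β > 0`, every real `r`
(the distance; the bound is trivial for `r < 0`) and every `n ≥ 1`,

  `ζⁿ · exp(−r²/(4nβ)) ≤ exp(−r·√(log(1/ζ)/β))`            (`fugacity_gaussian_le_exp_decay`)

(AM–GM in the exponent: `n·log(1/ζ) + r²/(4nβ) ≥ r√(log(1/ζ)/β)`, with equality at the saddle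
`n* = r/(2√(β log(1/ζ)))`), and hence for every `N` the partial sums obey

  `Σ_{n=1}^{N} ζⁿ (4πnβ)^{−3/2} exp(−r²/(4nβ)) ≤ exp(−r√(log(1/ζ)/β)) · Σ_{n=1}^{N} (4πnβ)^{−3/2}`
                                                            (`freeGasPartialSum_le_exp_decay`),

i.e. the subcritical free density matrix decays at rate at least `√(log(1/ζ)/β)`, uniformly in
the truncation (the right-hand sum converges to `ζ_R(3/2)(4πβ)^{−3/2}`). No ODLRO survives a
pointwise domination by such a kernel.

No axioms beyond Mathlib; sorry-free.
-/

namespace Summit.AtomisticToContinuum.BoseEinsteinCondensation.Theorems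

open Real Finset

/-- The exponent inequality behind the decay estimate: for `L, β > 0`-type data
(`0 ≤ L`, `0 < β`, `0 < n`, any real `r`), `r * √(L/β) ≤ n * L + r^2 / (4 * n * β)`.
Proof: with `s = √(L/β)`, `L = β s²` and the difference is `(2nβs − r)² / (4nβ) ≥ 0`. -/
theorem decay_exponent_le {L β r n : ℝ} (hL : 0 ≤ L) (hβ : 0 < β) (hn : 0 < n) :
    r * Real.sqrt (L / β) ≤ n * L + r ^ 2 / (4 * n * β) := by
  set s := Real.sqrt (L / β) with hs
  have hs0 : 0 ≤ s := Real.sqrt_nonneg _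
  have hs2 : s ^ 2 = L / β := by
    rw [hs, Real.sq_sqrt (div_nonneg hL hβ.le)]
  have hLs : L = β * s ^ 2 := by
    rw [hs2]; field_simp
  have h4 : 0 < 4 * n * β := by positivity
  rw [hLs]
  rw [← sub_nonneg]
  have key : n * (β * s ^ 2) + r ^ 2 / (4 * n * β) - r * s
      = (2 * n * β * s - r) ^ 2 / (4 * n * β) := by
    field_simp
    ring
  rw [key]
  positivity

/-- Termwise bound: for `0 < ζ < 1`, `0 < β`, `1 ≤ n` and any real `r`,
`ζ^n * exp(-(r^2/(4nβ))) ≤ exp(-(r * √(log(1/ζ)/β)))`. -/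
theorem fugacity_gaussian_le_exp_decay {ζ β r : ℝ} (hζ0 : 0 < ζ) (hζ1 : ζ < 1) (hβ : 0 < β)
    {n : ℕ} (hn : 1 ≤ n) :
    ζ ^ n * Real.exp (-(r ^ 2 / (4 * (n : ℝ) * β)))
      ≤ Real.exp (-(r * Real.sqrt (Real.log (1 / ζ) / β))) := by
  have hnpos : (0 : ℝ) < n := by exact_mod_cast hn
  have hL : 0 ≤ Real.log (1 / ζ) := by
    apply Real.log_nonneg
    exact (one_le_div hζ0).mpr hζ1.le
  -- ζ^n = exp (n * log ζ)
  have hzpow : ζ ^ n = Real.exp ((n : ℝ) * Real.log ζ) := by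
    rw [Real.exp_nat_mul, Real.exp_log hζ0]
  have hlog1 : Real.log (1 / ζ) = - Real.log ζ := by
    rw [one_div, Real.log_inv]
  rw [hzpow, ← Real.exp_add, Real.exp_le_exp]
  have key := decay_exponent_le (r := r) hL hβ hnpos
  rw [hlog1] at key ⊢
  linarith

/-- Partial sums of the free Bose gas one-body density matrix at fugacity `ζ < 1` decay at rate
`√(log(1/ζ)/β)`, uniformly in the truncation `N`. -/
theorem freeGasPartialSum_le_exp_decay {ζ β r : ℝ} (hζ0 : 0 < ζ) (hζ1 : ζ < 1) (hβ : 0 < β)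
    (N : ℕ) :
    (∑ n ∈ Finset.range N,
        ζ ^ (n + 1) * (4 * Real.pi * ((n : ℝ) + 1) * β) ^ (-(3 : ℝ) / 2)
          * Real.exp (-(r ^ 2 / (4 * ((n : ℝ) + 1) * β))))
      ≤ Real.exp (-(r * Real.sqrt (Real.log (1 / ζ) / β)))
          * ∑ n ∈ Finset.range N, (4 * Real.pi * ((n : ℝ) + 1) * β) ^ (-(3 : ℝ) / 2) := by
  rw [Finset.mul_sum]
  apply Finset.sum_le_sum
  intro n _
  have hc : 0 ≤ (4 * Real.pi * ((n : ℝ) + 1) * β) ^ (-(3 : ℝ) / 2) := by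
    apply Real.rpow_nonneg
    positivity
  have ht := fugacity_gaussian_le_exp_decay (r := r) hζ0 hζ1 hβ (n := n + 1) (by omega)
  have hcast : ((n + 1 : ℕ) : ℝ) = (n : ℝ) + 1 := by push_cast; ring
  rw [hcast] at ht
  calc ζ ^ (n + 1) * (4 * Real.pi * ((n : ℝ) + 1) * β) ^ (-(3 : ℝ) / 2)
          * Real.exp (-(r ^ 2 / (4 * ((n : ℝ) + 1) * β)))
        = (ζ ^ (n + 1) * Real.exp (-(r ^ 2 / (4 * ((n : ℝ) + 1) * β))))
            * (4 * Real.pi * ((n : ℝ) + 1) * β) ^ (-(3 : ℝ) / 2) := by ring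
    _ ≤ Real.exp (-(r * Real.sqrt (Real.log (1 / ζ) / β)))
            * (4 * Real.pi * ((n : ℝ) + 1) * β) ^ (-(3 : ℝ) / 2) :=
          mul_le_mul_of_nonneg_right ht hc

end Summit.AtomisticToContinuum.BoseEinsteinCondensation.Theorems
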